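import Summits.ValiantsHypothesis.ValiantsHypothesis.Theorems.KPlusLogSqLawTropicalBVisitedStates

/-!
# Route `KPlusLogSqLaw`, crux `TropicalB` — the visited-state engine, FIRST WORKED INSTANCE: labelled two-sided bands

HONEST FRAMING.  Helper file toward the registered stubs `stub_tropThin` / `stub_tropFat` of
`Cruxes/TropicalB/Lines/birth.lean` (crux `Summit.ValiantsHypothesis.ValiantsHypothesis.Theses.KPlusLogSqLaw.TropicalB`,
ledger item `stmt-ValiantsHypothesis-19771`, route `KPlusLogSqLaw`, DRAFT; cell `pub-symmetroid`, seat `val-sym-trop-p1`,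
2026-08-26).  A sector theorem; it does NOT prove either stub and asserts nothing about `TropicalB` for general supports,
`KPlusLogSqLaw`, `MatrixDescartes` or `VP ≠ VNP`.

THE CLASS.  A design of format `m` is a LABELLED TWO-SIDED BAND of width `w` if there are strictly increasing integer
labels `ρ` (rows) and `κ` (columns) with `ε a b l ≠ 0 → |ρ a − κ b| ≤ w`.  (With `ρ = κ = id` this is the ordinary band
`|a − b| ≤ w`; the labels make the class HEREDITARY under the column split: a restricted design keeps the original labels.)

DE-DUP / PRIORITY (lead ruling R1358, 2026-08-26): the two-sided-band BOUND itself — «O(1)^w cut states independent of m ⇒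
polynomially many breakpoints (K+1)·m^{O(w)}, hence the `K + log² m` inequality for w ≤ log₂ m» — is val-sym-trop-p5's
`…TropicalBBandedPolynomial` (p425296: `chain_lt_banded_poly`, `tropicalB_banded_polynomial`, via the all-states meta-theorem
`IntervalOpt.chain_le_of_states`), and the one-sided / K-adaptive band sectors are val-sym-trop-p3's (…TropicalBBanded,
…TropicalBSurplus).  THIS FILE is only the FIRST WORKED INSTANCE of the visited-state engine `designRowD_of_visitedStates`
(…TropicalBVisitedStates): it shows how a hereditary class `P` (here: «admits labels of width `w`»), a visited-state bound
`S = 4^w` and a budget `G t = (K+1)·(2·4^w+1)^t − 1` are fed to the engine.  No second proof of the band bound is intended;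
cite p5's decls for the bound.

* `labelBand_state_sandwich`, `card_ambiguous_le`, `labelBand_states_le` — at a cut with both blocks nonempty a present term's
  first-block row set is sandwiched between two sets differing in ≤ 2w rows, so ≤ 4^w states are visited (this is `hvisit`);
* `designRowD_labelBand_pow` — the engine call: `m ≤ 2^t` ⇒ unsigned row bound `(K + 1)·(2·4^w + 1)^t − 1`.
[folklore: transfer-matrix / Gusfield-type recursion, in the dominance vocabulary]
-/

set_option linter.dupNamespace false
set_option autoImplicit false

namespace Summit.ValiantsHypothesis.ValiantsHypothesis.Theorems.KPlusLogSqLaw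

open Summit.ValiantsHypothesis.ValiantsHypothesis.Theorems.MatrixDescartes.Negative
open Summit.ValiantsHypothesis.ValiantsHypothesis.Theorems.LacunarySymmetroidMatrixDescartes
open Summit.ValiantsHypothesis.ValiantsHypothesis.Theorems.LacunarySymmetroidMatrixDescartes.TropicalCensus
open scoped BigOperators
open Finset

/-! ## 1. The state count of a labelled band -/

section States

variable {c e K : ℕ}

/-- **States of a labelled band.**  For a present term of a design of format `c + e` with strictly increasing labels
`ρ, κ` and `|ρ a − κ b| ≤ w` on the support (`1 ≤ c`, `1 ≤ e`), the first-block row set `R` satisfies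
`{a : ρ a < κ (natAdd c 0) − w} ⊆ R ⊆ {a : ρ a ≤ κ (castAdd e (c−1)) + w}`. [folklore] -/
theorem labelBand_state_sandwich (w : ℕ) (ρ κ : Fin (c + e) → ℤ) (hκ : StrictMono κ)
    (ε : Fin (c + e) → Fin (c + e) → Fin K → ℤ) (hband : ∀ a b l, ε a b l ≠ 0 → |ρ a - κ b| ≤ w)
    (hc : 1 ≤ c) (he : 1 ≤ e) (q : Equiv.Perm (Fin (c + e)) × (Fin (c + e) → Fin K)) (hq : termSign ε q ≠ 0) :
    (univ.filter fun a => ρ a < κ (Fin.natAdd c ⟨0, he⟩) - w) ⊆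
        (univ : Finset (Fin c)).image (fun j => q.1 (Fin.castAdd e j)) ∧
      (univ : Finset (Fin c)).image (fun j => q.1 (Fin.castAdd e j)) ⊆
        univ.filter fun a => ρ a ≤ κ (Fin.castAdd e ⟨c - 1, by omega⟩) + w := by
  classical
  have hpres := (termSign_ne_zero_iff ε q).mp hq
  constructor
  · intro a ha
    rw [mem_filter] at ha
    -- `a = q.1 x`; `x` must be a first-block column
    obtain ⟨x, hx⟩ := q.1.surjective a
    induction x using Fin.addCases with
    | left j => exact mem_image.mpr ⟨j, mem_univ _, hx⟩
    | right j =>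
      exfalso
      have h1 := hband _ _ _ (hpres (Fin.natAdd c j))
      rw [hx] at h1
      have h2 : κ (Fin.natAdd c ⟨0, he⟩) ≤ κ (Fin.natAdd c j) :=
        hκ.monotone (by rw [Fin.le_def]; simp)
      have h3 := (abs_le.mp h1).1
      have := ha.2
      omega
  · intro a ha
    obtain ⟨j, _, rfl⟩ := mem_image.mp ha
    rw [mem_filter]
    refine ⟨mem_univ _, ?_⟩
    have h1 := hband _ _ _ (hpres (Fin.castAdd e j))
    have h2 : κ (Fin.castAdd e j) ≤ κ (Fin.castAdd e ⟨c - 1, by omega⟩) :=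
      hκ.monotone (by rw [Fin.le_def]; simp only [Fin.val_castAdd]; omega)
    have h3 := (abs_le.mp h1).2
    omega

/-- the ambiguous rows of a labelled band number at most `2w`. [folklore] -/
theorem card_ambiguous_le (w : ℕ) (ρ κ : Fin (c + e) → ℤ) (hρ : StrictMono ρ) (hκ : StrictMono κ)
    (hc : 1 ≤ c) (he : 1 ≤ e) :
    ((univ.filter fun a => ρ a ≤ κ (Fin.castAdd e ⟨c - 1, by omega⟩) + w) \
      (univ.filter fun a => ρ a < κ (Fin.natAdd c ⟨0, he⟩) - w)).card ≤ 2 * w := by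
  classical
  set lo := κ (Fin.natAdd c ⟨0, he⟩) - w with hlo
  set hi := κ (Fin.castAdd e ⟨c - 1, by omega⟩) + w with hhi
  have hκlt : κ (Fin.castAdd e ⟨c - 1, by omega⟩) < κ (Fin.natAdd c ⟨0, he⟩) :=
    hκ (by rw [Fin.lt_def]; simp only [Fin.val_castAdd, Fin.val_natAdd]; omega)
  -- the ambiguous rows inject, via `ρ`, into the integer interval `[lo, hi]`
  calc ((univ.filter fun a => ρ a ≤ hi) \ (univ.filter fun a => ρ a < lo)).card
      ≤ (Finset.Icc lo hi).card := by
        refine card_le_card_of_injOn ρ (fun a ha => ?_) (fun a _ b _ h => hρ.injective h)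
        have ha' := mem_coe.mp ha
        rw [mem_sdiff, mem_filter, mem_filter] at ha'
        push Not at ha'
        exact mem_coe.mpr (mem_Icc.mpr ⟨ha'.2 (mem_univ _), ha'.1.2⟩)
    _ ≤ 2 * w := by
        rw [Int.card_Icc]
        have h2 : hi + 1 - lo ≤ ((2 * w : ℕ) : ℤ) := by push_cast; simp only [hlo, hhi]; omega
        calc (hi + 1 - lo).toNat ≤ ((2 * w : ℕ) : ℤ).toNat := Int.toNat_le_toNat h2
          _ = 2 * w := Int.toNat_natCast _

/-- **Visited states of a labelled band**: along any chain (indeed over all present terms) at most `4^w` first-block row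
sets occur at a cut with both blocks nonempty. [folklore] -/
theorem labelBand_states_le (w : ℕ) (ρ κ : Fin (c + e) → ℤ) (hρ : StrictMono ρ) (hκ : StrictMono κ)
    (ε : Fin (c + e) → Fin (c + e) → Fin K → ℤ) (hband : ∀ a b l, ε a b l ≠ 0 → |ρ a - κ b| ≤ w)
    (hc : 1 ≤ c) (he : 1 ≤ e) {n : ℕ} (p : Fin (n + 1) → Equiv.Perm (Fin (c + e)) × (Fin (c + e) → Fin K))
    (hp : ∀ k, termSign ε (p k) ≠ 0) :
    ((univ : Finset (Fin (n + 1))).image fun k =>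
        (univ : Finset (Fin c)).image fun j => (p k).1 (Fin.castAdd e j)).card ≤ 4 ^ w := by
  classical
  set S₁ := (univ : Finset (Fin (c + e))).filter fun a => ρ a < κ (Fin.natAdd c ⟨0, he⟩) - w with hS₁
  set S₂ := (univ : Finset (Fin (c + e))).filter fun a => ρ a ≤ κ (Fin.castAdd e ⟨c - 1, by omega⟩) + w with hS₂
  have hsand : ∀ k, S₁ ⊆ (univ : Finset (Fin c)).image (fun j => (p k).1 (Fin.castAdd e j)) ∧
      (univ : Finset (Fin c)).image (fun j => (p k).1 (Fin.castAdd e j)) ⊆ S₂ :=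
    fun k => labelBand_state_sandwich w ρ κ hκ ε hband hc he (p k) (hp k)
  -- inject the visited states into the powerset of the ambiguous rows via `R ↦ R \ S₁`
  calc ((univ : Finset (Fin (n + 1))).image fun k =>
          (univ : Finset (Fin c)).image fun j => (p k).1 (Fin.castAdd e j)).card
      ≤ ((S₂ \ S₁).powerset).card := by
        refine card_le_card_of_injOn (fun R => R \ S₁) (fun R hR => ?_) (fun R hR R' hR' h => ?_)
        · obtain ⟨k, _, rfl⟩ := mem_image.mp (mem_coe.mp hR)
          exact mem_coe.mpr (mem_powerset.mpr (sdiff_subset_sdiff (hsand k).2 le_rfl))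
        · obtain ⟨k, _, rfl⟩ := mem_image.mp (mem_coe.mp hR)
          obtain ⟨k', _, rfl⟩ := mem_image.mp (mem_coe.mp hR')
          have e1 := union_sdiff_of_subset (hsand k).1
          have e2 := union_sdiff_of_subset (hsand k').1
          rw [← e1, ← e2]
          simp only at h
          rw [h]
    _ = 2 ^ (S₂ \ S₁).card := card_powerset _
    _ ≤ 2 ^ (2 * w) := Nat.pow_le_pow_right (by norm_num) (card_ambiguous_le w ρ κ hρ hκ hc he)
    _ = 4 ^ w := by rw [pow_mul]; norm_num

end States

/-! ## 2. The sector theorem via the visited-state engine -/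

/-- **Labelled two-sided bands, dyadic form**: a design of format `m ≤ 2^t` admitting strictly increasing integer labels
`ρ, κ` with `|ρ a − κ b| ≤ w` on its support has unsigned row bound `(K + 1)·(2·4^w + 1)^t − 1`. [folklore] -/
theorem designRowD_labelBand_pow (K w t : ℕ) : ∀ m : ℕ, m ≤ 2 ^ t →
    ∀ (d : Fin K → ℕ) (v ε : Fin m → Fin m → Fin K → ℤ),
      (∃ ρ κ : Fin m → ℤ, StrictMono ρ ∧ StrictMono κ ∧ ∀ a b l, ε a b l ≠ 0 → |ρ a - κ b| ≤ w) →
      DesignRowD d v ε ((K + 1) * (2 * 4 ^ w + 1) ^ t - 1) := by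
  classical
  refine designRowD_of_visitedStates (K := K)
    (fun m _ _ ε => ∃ ρ κ : Fin m → ℤ, StrictMono ρ ∧ StrictMono κ ∧ ∀ a b l, ε a b l ≠ 0 → |ρ a - κ b| ≤ w)
    (fun _ => 4 ^ w) (fun t => (K + 1) * (2 * 4 ^ w + 1) ^ t - 1) ?_ ?_ ?_ ?_ ?_ ?_ ?_ t
  · -- `Fin.cast` invariance
    rintro m m' h d v ε ⟨ρ, κ, hρ, hκ, hb⟩
    subst h
    exact ⟨ρ, κ, hρ, hκ, hb⟩
  · -- heredity, first block
    rintro c e d v ε ⟨ρ, κ, hρ, hκ, hb⟩ q _ r _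
    exact ⟨fun i => ρ (r i), fun j => κ (Fin.castAdd e j), hρ.comp r.strictMono,
      hκ.comp (fun j j' h => by rwa [Fin.lt_def, Fin.val_castAdd, Fin.val_castAdd, ← Fin.lt_def]),
      fun a b l h => hb _ _ _ h⟩
  · -- heredity, second block
    rintro c e d v ε ⟨ρ, κ, hρ, hκ, hb⟩ q _ r _
    exact ⟨fun i => ρ (r i), fun j => κ (Fin.natAdd c j), hρ.comp r.strictMono,
      hκ.comp (fun j j' h => by rw [Fin.lt_def, Fin.val_natAdd, Fin.val_natAdd]; rw [Fin.lt_def] at h; omega),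
      fun a b l h => hb _ _ _ h⟩
  · -- visited-state bound
    rintro c e d v ε ⟨ρ, κ, hρ, hκ, hb⟩ hc hm n θ p _ hdom _
    exact labelBand_states_le w ρ κ hρ hκ ε hb (by omega) (by omega) p (fun k => (hdom k).1)
  · -- `K ≤ G 0`
    simp
  · -- `G` monotone
    intro t t' htt'
    show (K + 1) * (2 * 4 ^ w + 1) ^ t - 1 ≤ (K + 1) * (2 * 4 ^ w + 1) ^ t' - 1
    have h1 : (2 * 4 ^ w + 1) ^ t ≤ (2 * 4 ^ w + 1) ^ t' := Nat.pow_le_pow_right (by positivity) htt'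
    have := Nat.mul_le_mul_left (K + 1) h1
    omega
  · -- one level of the recursion
    intro t m _ _
    show 4 ^ w * ((K + 1) * (2 * 4 ^ w + 1) ^ t - 1 + ((K + 1) * (2 * 4 ^ w + 1) ^ t - 1) + 1) ≤
      (K + 1) * (2 * 4 ^ w + 1) ^ (t + 1) - 1 + 1
    set A := 2 * 4 ^ w + 1 with hA
    set G := (K + 1) * A ^ t with hG
    have hGpos : 1 ≤ G := by
      have : 1 ≤ A ^ t := Nat.one_le_pow _ _ (by positivity)
      simp only [hG]; nlinarith
    have e1 : (K + 1) * A ^ (t + 1) = A * G := by simp only [hG, pow_succ]; ring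
    rw [e1]
    have h4 : 1 ≤ 4 ^ w := Nat.one_le_pow _ _ (by norm_num)
    -- `4^w · (2(G−1) + 1) ≤ A·G − 1 + 1`
    have : 4 ^ w * (G - 1 + (G - 1) + 1) + 1 ≤ A * G + 1 := by
      have h5 : 4 ^ w * (G - 1 + (G - 1) + 1) ≤ 2 * 4 ^ w * G := by
        have : G - 1 + (G - 1) + 1 ≤ 2 * G := by omega
        calc 4 ^ w * (G - 1 + (G - 1) + 1) ≤ 4 ^ w * (2 * G) := Nat.mul_le_mul_left _ this
          _ = 2 * 4 ^ w * G := by ring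
      have h6 : 2 * 4 ^ w * G ≤ A * G := Nat.mul_le_mul_right _ (by omega)
      omega
    omega

end Summit.ValiantsHypothesis.ValiantsHypothesis.Theorems.KPlusLogSqLaw
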